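import Mathlib
import Literature.NumberTheory.LFunctions.Zhang2022.Section8aFamilyFourthMomentsPoly
import Literature.NumberTheory.LFunctions.Zhang2022.Section6Lemma61Closed
import Literature.NumberTheory.LFunctions.Zhang2022.Section5Lemma51
import Literature.NumberTheory.LFunctions.Zhang2022.Section4Eq46Holds
import HarnessLib

/-!
# Zhang (2022) §8 p. 43 / Lemma 6.1: the PUBLIC family fourth moment of `L(w,ψ)` over any finite
# subfamily of `Ψ`, uniformly on the strip `|Re w − ½| < 2α`, `|Im w − 2πt₀| < 𝓛₁ + 2` — unconditional

Topic `Literature/NumberTheory/LFunctions/Zhang2022` (Landau–Siegel audit tree; verdict-neutral).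
Y. Zhang, *Discrete mean estimates and the Landau–Siegel zero*, arXiv:2211.02515v1 (2022)
[Zhang2022LandauSiegel] — **an unrefereed manuscript under adjudication; nothing here asserts or
denies its Theorems 1–2.** ZHANG-L lane, LIB-B shape adapter: helper (H2) under the leaf
`Typed.Section15A.Eq15_6`, node §15.u008 (β) `Typed.Section15A.Step15_u008beta` (the factor
`(Σ_{Ψ₁}|L(s+β₂,ψ)|⁴)^{1/4}` of its Hölder step, `s ∈ 𝔍(−α)`, i.e. `Re = ½ − α`), and for every other
"Cauchy's inequality, Lemma 6.1 and Lemma 3.3" step (§8 p. 43 `Z22:§8.u013`; §13 (13.11); §17).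

The tree proves `Σ_{ψ∈Ψ₁}|L(w,ψ)|⁴ ≪ P²𝓛³⁶` PRIVATELY and on the line `Re w = ½ + α` only
(`Section8aFourthMoment.fourth_moment_L_refl`, consumed by `step8u013_ofAR`). Here the bound is
re-derived as a PUBLIC theorem, for ANY finite family `T` of members of `Ψ`, on the whole open strip
`|Re w − ½| < 2α` (the range of Lemma 6.1), and UNCONDITIONALLY: Lemma 6.1 enters through the tree's
kernel-closed reflected form `Section6Statements.lemma61_reflected`
(`|L(w,ψ) − K(w,ψ) − Z(w,ψ)N(1−w,ψ̄)| ≤ C(E₁(1−w̄,ψ) + e^{−c𝓛¹⁰})`, all `ψ ∈ Ψ`, under (A)).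
Then `|L| ≤ |K| + e¹³|N(1−w,ψ̄)| + C·E₁(1−w̄,ψ) + C·ε` (`|Z(w,ψ)| ≤ e¹³`, `norm_Zfac_le_exp_thirteen`,
Stirling via the tree's `GammaFactor.norm_Zfac_le_exp_of_abs_sub_half_le`), `(a+b+c+d)⁴ ≤ 64Σa⁴`, and
the strip-uniform family fourth moments of the companion file `Section8aFamilyFourthMomentsPoly`
(`sum_norm_Kchar_pow_four_le`, `sum_norm_NcharBar_pow_four_le`, `sum_E1main_pow_four_le` — the
points `1 − w`, `1 − w̄` lie in the same strip), plus `#T ≪ P²𝓛⁹` (`Typed.Section13.card_le_meanSq`)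
for the `ε`-term:

* `sum_norm_LFunction_pow_four_le` — `∃ C, ForAllLarge: (A) → ∀ T w, |Re w − ½| < 2α →
  |Im w − 2πt₀| < 𝓛₁ + 2 → Σ_{ψ∈T} |L(w,ψ)|⁴ ≤ C·P²·𝓛³⁶`;
* `sum_norm_LFunction_shift_pow_four_le` — the segment form: for `s` on the strip with
  `|Im s − 2πt₀| ≤ 𝓛₁` and a purely imaginary shift `β`, `|Im β| < 2` (the `β_j` of (2.13), or `β_j`
  plus the `iv` of `E₁`), the bound at `w = s + β`.

Theorems only; no definitions, no new named facts; axioms standard.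

## References

* Y. Zhang, arXiv:2211.02515v1 (2022), §8 p. 43 (tex L2244–2247); §6 Lemma 6.1 p. 30; §5 Lemma 5.1
  (proof) p. 10; §3 Lemma 3.3 p. 14; §2 (2.8)–(2.13). [cite: Zhang2022LandauSiegel, §8 p.43]
-/

noncomputable section

open Complex Real ComplexConjugate Filter MeasureTheory

namespace Literature.NumberTheory.LFunctions.Zhang2022.FourthMoments

open Skeleton MeanSquareMajorant Section7Eq75

/-! ## A. `|Z(w,ψ)| ≤ e¹³` on the range of Lemma 6.1 -/

/-- `|log(kt/2π)| ≤ 2𝓛⁹` for `1 ≤ k`, `log k ≤ 𝓛⁹ + 𝓛 + 1`, `5𝓛⁵¹⁹ ≤ t ≤ 8𝓛⁵¹⁹` (`𝓛 ≥ 3`).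
[cite: Zhang2022LandauSiegel, §5 Lemma 5.1 (proof)] -/
theorem abs_log_kt_div_two_pi_le {L t K : ℝ} (hL : 3 ≤ L) (ht5 : 5 * L ^ 519 ≤ t)
    (ht8 : t ≤ 8 * L ^ 519) (hK1 : 1 ≤ K) (hK : Real.log K ≤ L ^ 9 + L + 1) :
    |Real.log (K * t / (2 * π))| ≤ 2 * L ^ 9 := by
  have hL1 : 1 ≤ L := by linarith
  have hL0 : 0 < L := by linarith
  have hK0 : 0 < K := by linarith
  have h519 : (1 : ℝ) ≤ L ^ 519 := one_le_pow₀ hL1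
  have h519' : (3 : ℝ) ≤ L ^ 519 := hL.trans (le_self_pow₀ hL1 (by norm_num))
  have ht0 : 0 < t := by linarith
  have hy1 : 1 ≤ K * t / (2 * π) := by
    rw [le_div_iff₀ (by positivity), one_mul]
    have hKt : t ≤ K * t := le_mul_of_one_le_left ht0.le hK1
    linarith [Real.pi_lt_four]
  rw [abs_of_nonneg (Real.log_nonneg hy1), mul_div_assoc, Real.log_mul hK0.ne' (by positivity)]
  have hlogt : Real.log (t / (2 * π)) ≤ 3 + 519 * L := by
    have h1 : t / (2 * π) ≤ 8 * L ^ 519 := by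
      rw [div_le_iff₀ (by positivity)]; nlinarith [Real.pi_gt_three, pow_pos hL0 519]
    have h2 : 0 < t / (2 * π) := by positivity
    calc Real.log (t / (2 * π)) ≤ Real.log (8 * L ^ 519) := Real.log_le_log h2 h1
      _ = Real.log 8 + 519 * Real.log L := by
          rw [Real.log_mul (by norm_num) (by positivity), Real.log_pow]; push_cast; ring
      _ ≤ 3 + 519 * L := by
          have h8 : Real.log 8 ≤ 3 := by
            rw [show (8 : ℝ) = 2 ^ 3 by norm_num, Real.log_pow]; push_cast
            linarith [Real.log_two_lt_d9]
          have hLL : Real.log L ≤ L := (Real.log_le_sub_one_of_pos hL0).trans (by linarith)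
          linarith
  have h9 : 520 * L + 4 ≤ L ^ 9 := by
    have h1 : L ^ 9 = L * L ^ 8 := by ring
    have h8 : (3 : ℝ) ^ 8 ≤ L ^ 8 := pow_le_pow_left₀ (by norm_num) hL 8
    nlinarith
  linarith

/-- **`|Z(w,ψ)| ≤ e¹³` on the range of Lemma 6.1**: for `𝓛 ≥ 3`, `ψ ∈ Ψ`, `|Re w − ½| < 2α` and
`|Im w − 2πt₀| < 𝓛₁ + 2` — Stirling (`GammaFactor.norm_Zfac_le_exp_of_abs_sub_half_le`:
`|Z(σ+it,θ)| ≤ exp(|σ − ½|(|log(kt/2π)| + 14/t))`) with `|σ − ½| < 2π𝓛⁻⁹`, `|log(pt/2π)| ≤ 2𝓛⁹`.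
Public twin of the private `Section8aStatements.norm_Zfac_le_exp13`.
[cite: Zhang2022LandauSiegel, §6 Lemma 6.1 p.30; §5 Lemma 5.1 (proof)] -/
theorem norm_Zfac_le_exp_thirteen {D : ℕ} (hL3 : 3 ≤ ell D) (x : Chr D) {w : ℂ}
    (hσ : |w.re - 1 / 2| < 2 * alpha D) (htr : |w.im - 2 * π * t0 D| < ell1 D + 2) :
    ‖GammaFactor.Zfac x.ψ w‖ ≤ Real.exp 13 := by
  have hL0 : 0 < ell D := by linarith
  have hL1 : 1 ≤ ell D := by linarith
  obtain ⟨σ, t, rfl⟩ : ∃ σ' t' : ℝ, w = σ' + t' * I := ⟨w.re, w.im, (re_add_im w).symm⟩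
  have hσ' : |σ - 1 / 2| < 2 * alpha D := by simpa using hσ
  have htr' : |t - 2 * π * ell D ^ 519| < ell D ^ 405 + 2 := by
    have h := htr
    rw [ell1, t0] at h
    simpa using h
  have hα : alpha D = π / ell D ^ 9 := by rw [alpha, bigP, Real.log_exp]
  obtain ⟨ht5, ht8⟩ := Section6Statements.t_range hL3 htr'
  have h519 : (1 : ℝ) ≤ ell D ^ 519 := one_le_pow₀ hL1
  have ht4 : 4 ≤ t := by linarith
  have ht0 : 0 < t := by linarith
  have h9pos : 0 < ell D ^ 9 := by positivity
  have hσ4 : |σ - 1 / 2| ≤ 1 / 4 := hσ'.le.trans (two_alpha_le_quarter hL3)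
  obtain ⟨hPp, hpP⟩ := Section4.bigP_lt_p_and_lt x
  have hP0 : 0 < bigP D := Real.exp_pos _
  have hlogP : Real.log (bigP D) = ell D ^ 9 := by rw [bigP, Real.log_exp]
  have hp0 : (0 : ℝ) < x.p := hP0.trans hPp
  have hp1 : (1 : ℝ) ≤ x.p := by exact_mod_cast x.prime.one_lt.le
  have hlogp : Real.log (x.p : ℝ) ≤ ell D ^ 9 + ell D + 1 := by
    have h68 : (ell D ^ 68)⁻¹ ≤ 1 := inv_le_one_of_one_le₀ (one_le_pow₀ hL1)
    have h4 : (x.p : ℝ) ≤ bigP D * 2 :=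
      hpP.le.trans (mul_le_mul_of_nonneg_left (by linarith) hP0.le)
    calc Real.log (x.p : ℝ) ≤ Real.log (bigP D * 2) := Real.log_le_log hp0 h4
      _ = ell D ^ 9 + Real.log 2 := by rw [Real.log_mul hP0.ne' two_ne_zero, hlogP]
      _ ≤ ell D ^ 9 + ell D + 1 := by linarith [Real.log_two_lt_d9]
  have hlog : |Real.log ((x.p : ℝ) * t / (2 * π))| ≤ 2 * ell D ^ 9 :=
    abs_log_kt_div_two_pi_le hL3 ht5 ht8 hp1 hlogp
  have h14 : 14 / t ≤ 4 := by rw [div_le_iff₀ ht0]; linarith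
  refine (GammaFactor.norm_Zfac_le_exp_of_abs_sub_half_le x.prim hσ4 ht4).trans
    (Real.exp_le_exp.mpr ?_)
  have ha : |σ - 1 / 2| ≤ 2 * π / ell D ^ 9 := by
    rw [hα, ← mul_div_assoc] at hσ'
    exact hσ'.le
  calc |σ - 1 / 2| * (|Real.log ((x.p : ℝ) * t / (2 * π))| + 14 / t)
      ≤ (2 * π / ell D ^ 9) * (2 * ell D ^ 9 + 4) :=
        mul_le_mul ha (by linarith) (by positivity) (by positivity)
    _ = 4 * π + 8 * π / ell D ^ 9 := by field_simp; ring
    _ ≤ 13 := by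
        have h : 8 * π / ell D ^ 9 ≤ 1 / 100 := by
          rw [div_le_iff₀ h9pos]
          have hL9 : (3 : ℝ) ^ 9 ≤ ell D ^ 9 := pow_le_pow_left₀ (by norm_num) hL3 9
          nlinarith [Real.pi_lt_four]
        linarith [Real.pi_lt_d2]

/-! ## B. The fourth moment of `L(w,ψ)` over a finite subfamily of `Ψ` -/

/-- `(a+b+c+d)⁴ ≤ 64(a⁴+b⁴+c⁴+d⁴)` (Cauchy's inequality twice). [folklore] -/
private theorem add_four_pow_four_le (a b c d : ℝ) :
    (a + b + c + d) ^ 4 ≤ 64 * (a ^ 4 + b ^ 4 + c ^ 4 + d ^ 4) := by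
  have h1 : (a + b + c + d) ^ 2 ≤ 4 * (a ^ 2 + b ^ 2 + c ^ 2 + d ^ 2) := by
    nlinarith [sq_nonneg (a - b), sq_nonneg (a - c), sq_nonneg (a - d), sq_nonneg (b - c),
      sq_nonneg (b - d), sq_nonneg (c - d)]
  have h2 : (a ^ 2 + b ^ 2 + c ^ 2 + d ^ 2) ^ 2 ≤ 4 * (a ^ 4 + b ^ 4 + c ^ 4 + d ^ 4) := by
    nlinarith [sq_nonneg (a ^ 2 - b ^ 2), sq_nonneg (a ^ 2 - c ^ 2), sq_nonneg (a ^ 2 - d ^ 2),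
      sq_nonneg (b ^ 2 - c ^ 2), sq_nonneg (b ^ 2 - d ^ 2), sq_nonneg (c ^ 2 - d ^ 2)]
  calc (a + b + c + d) ^ 4 = ((a + b + c + d) ^ 2) ^ 2 := by ring
    _ ≤ (4 * (a ^ 2 + b ^ 2 + c ^ 2 + d ^ 2)) ^ 2 := pow_le_pow_left₀ (sq_nonneg _) h1 2
    _ = 16 * (a ^ 2 + b ^ 2 + c ^ 2 + d ^ 2) ^ 2 := by ring
    _ ≤ 16 * (4 * (a ^ 4 + b ^ 4 + c ^ 4 + d ^ 4)) := by linarith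
    _ = _ := by ring

/-- **The size of a finite subfamily of `Ψ`**: `#T ≤ 3C₃₃e^{8π}·P²·𝓛⁹` for `𝓛 ≥ 1`, `1 ≤ ⌊P²⌋`
(the large sieve applied to the constant polynomial, `Typed.Section13.card_le_meanSq`, with the weight
sum `Σ_{n≤P²} n^{−1−2α} ≤ e^{8π}(1 + 2𝓛⁹)`). [cite: Zhang2022LandauSiegel, Lemma 3.3 p.14] -/
theorem card_le_bigP_sq {D : ℕ} (hL : 1 ≤ ell D) (hP : 1 ≤ ⌊bigP D ^ 2⌋₊) (T : Finset (Chr D)) :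
    (T.card : ℝ) ≤ (2 + 2 * (3 + (Real.log 2 ^ 68)⁻¹) ^ 2) * bigP D ^ 2 *
      (Real.exp (8 * π) * (3 * ell D ^ 9)) := by
  have hα : alpha D = π / ell D ^ 9 := by rw [alpha, bigP, Real.log_exp]
  have hL0 : 0 < ell D := by linarith
  have hα0 : 0 ≤ alpha D := by rw [hα]; positivity
  set s : ℂ := ((1 / 2 + alpha D : ℝ) : ℂ) with hs
  have hsre : s.re = 1 / 2 + alpha D := by rw [hs]; simp
  have h1 := Typed.Section13.card_le_meanSq T s hP
  have he : |-2 * s.re + 1| ≤ 4 * alpha D := by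
    rw [hsre, show -2 * (1 / 2 + alpha D) + 1 = -(2 * alpha D) by ring, abs_neg,
      abs_of_nonneg (by positivity)]
    linarith
  have h2 := Typed.Section13.sum_rpow_Icc_le hL he
  have h3 : Real.exp (8 * π) * (1 + 2 * ell D ^ 9) ≤ Real.exp (8 * π) * (3 * ell D ^ 9) := by
    refine mul_le_mul_of_nonneg_left ?_ (Real.exp_nonneg _)
    have : 1 ≤ ell D ^ 9 := one_le_pow₀ hL
    linarith
  exact h1.trans (mul_le_mul_of_nonneg_left (h2.trans h3)
    (mul_nonneg Typed.Section13.c33_nonneg (by positivity)))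

/-- **`Σ_{ψ∈T} |L(w,ψ)|⁴ ≤ C·P²·𝓛³⁶`** for any finite family `T` of members of `Ψ`, every `w` with
`|Re w − ½| < 2α` and `|Im w − 2πt₀| < 𝓛₁ + 2`, all large `D` and every real primitive `χ (mod D)`
satisfying (A) — UNCONDITIONAL (Lemma 6.1 enters as the tree's kernel-closed
`Section6Statements.lemma61_reflected`): `|L| ≤ |K| + e¹³|N(1−w,ψ̄)| + C(E₁(1−w̄,ψ) + ε)`,
`(a+b+c+d)⁴ ≤ 64Σa⁴`, the strip-uniform family fourth moments of `K`, `N̄`, `E₁`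
(`Section8aFamilyFourthMomentsPoly`), and `#T ≪ P²𝓛⁹` for the `ε`-term.
[cite: Zhang2022LandauSiegel, §8 p.43, tex L2244–2247; §6 Lemma 6.1 p.30] -/
theorem sum_norm_LFunction_pow_four_le : ∃ C : ℝ, ForAllLarge fun D _ χ => AssumptionA D χ →
    ∀ (T : Finset (Chr D)) (w : ℂ), |w.re - 1 / 2| < 2 * alpha D →
      |w.im - 2 * π * t0 D| < ell1 D + 2 →
        ∑ x ∈ T, ‖x.ψ.LFunction w‖ ^ 4 ≤ C * bigP D ^ 2 * ell D ^ 36 := by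
  obtain ⟨c, hc, C61, D61, h61'⟩ := Section6Statements.lemma61_reflected
  obtain ⟨CK, DK, hK⟩ := sum_norm_Kchar_pow_four_le
  obtain ⟨CN, DN, hN⟩ := sum_norm_NcharBar_pow_four_le
  obtain ⟨CE, DE, hE⟩ := sum_E1main_pow_four_le
  obtain ⟨D₁, h₁⟩ := eventually_sizes
  set C' : ℝ := max C61 0 with hC'
  set Cc : ℝ := (2 + 2 * (3 + (Real.log 2 ^ 68)⁻¹) ^ 2) * (Real.exp (8 * π) * 3) with hCc
  refine ⟨64 * (CK + Real.exp 13 ^ 4 * CN + C' ^ 4 * CE + C' ^ 4 * Cc),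
    max (max (max D61 DK) (max DN DE)) D₁, fun D _ χ hD hq hp hA T w hw him => ?_⟩
  have hD61 : D61 ≤ D := le_trans (le_trans (le_trans (le_max_left _ _) (le_max_left _ _)) (le_max_left _ _)) hD
  have hDK : DK ≤ D := le_trans (le_trans (le_trans (le_max_right _ _) (le_max_left _ _)) (le_max_left _ _)) hD
  have hDN : DN ≤ D := le_trans (le_trans (le_trans (le_max_left _ _) (le_max_right _ _)) (le_max_left _ _)) hD
  have hDE : DE ≤ D := le_trans (le_trans (le_trans (le_max_right _ _) (le_max_right _ _)) (le_max_left _ _)) hD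
  have hD₁ : D₁ ≤ D := le_trans (le_max_right _ _) hD
  obtain ⟨hL3, -, -, hK2, -⟩ := h₁ D hD₁
  have hL1 : 1 ≤ ell D := by linarith
  have hK1 : 1 ≤ ⌊bigP D ^ 2⌋₊ := by omega
  -- the points `1 − w` and `1 − w̄` lie on the strip
  have h1w : |(1 - w).re - 1 / 2| ≤ 2 * alpha D := by
    have : (1 - w).re - 1 / 2 = -(w.re - 1 / 2) := by simp; ring
    rw [this, abs_neg]; exact hw.le
  have h1wc : |(1 - conj w).re - 1 / 2| ≤ 2 * alpha D := by
    have : (1 - conj w).re - 1 / 2 = -(w.re - 1 / 2) := by simp; ring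
    rw [this, abs_neg]; exact hw.le
  set ε : ℝ := Real.exp (-c * ell D ^ 10) with hε
  have hε0 : 0 ≤ ε := (Real.exp_pos _).le
  have hC'0 : 0 ≤ C' := le_max_right _ _
  -- Lemma 6.1 (reflected), per `ψ`
  have hLψ : ∀ x : Chr D, ‖x.ψ.LFunction w‖ ≤ ‖Kchar D (psiFn x) w‖ +
      Real.exp 13 * ‖Nchar D (psiBarFn x) (1 - w)‖ + C' * E1main x (1 - conj w) + C' * ε := by
    intro x
    have h := h61' D χ hD61 hq hp hA x w hw him
    have hZ := norm_Zfac_le_exp_thirteen hL3 x hw him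
    have hE0 := E1main_nonneg x (1 - conj w)
    have hR : ‖x.ψ.LFunction w - Kchar D (psiFn x) w -
        GammaFactor.Zfac x.ψ w * Nchar D (psiBarFn x) (1 - w)‖ ≤ C' * (E1main x (1 - conj w) + ε) :=
      h.trans (mul_le_mul_of_nonneg_right (le_max_left _ _) (by positivity))
    have hZN : ‖GammaFactor.Zfac x.ψ w * Nchar D (psiBarFn x) (1 - w)‖ ≤
        Real.exp 13 * ‖Nchar D (psiBarFn x) (1 - w)‖ := by
      rw [norm_mul]
      exact mul_le_mul_of_nonneg_right hZ (norm_nonneg _)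
    calc ‖x.ψ.LFunction w‖
        = ‖(x.ψ.LFunction w - Kchar D (psiFn x) w -
              GammaFactor.Zfac x.ψ w * Nchar D (psiBarFn x) (1 - w)) +
            Kchar D (psiFn x) w + GammaFactor.Zfac x.ψ w * Nchar D (psiBarFn x) (1 - w)‖ := by
          congr 1; ring
      _ ≤ ‖x.ψ.LFunction w - Kchar D (psiFn x) w -
              GammaFactor.Zfac x.ψ w * Nchar D (psiBarFn x) (1 - w)‖ +
            ‖Kchar D (psiFn x) w‖ + ‖GammaFactor.Zfac x.ψ w * Nchar D (psiBarFn x) (1 - w)‖ :=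
          norm_add₃_le
      _ ≤ C' * (E1main x (1 - conj w) + ε) + ‖Kchar D (psiFn x) w‖ +
            Real.exp 13 * ‖Nchar D (psiBarFn x) (1 - w)‖ := by linarith
      _ = _ := by ring
  -- fourth powers, per `ψ`
  have hL4 : ∀ x : Chr D, ‖x.ψ.LFunction w‖ ^ 4 ≤ 64 * (‖Kchar D (psiFn x) w‖ ^ 4 +
      Real.exp 13 ^ 4 * ‖Nchar D (psiBarFn x) (1 - w)‖ ^ 4 + C' ^ 4 * E1main x (1 - conj w) ^ 4 +
        C' ^ 4 * ε ^ 4) := by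
    intro x
    calc ‖x.ψ.LFunction w‖ ^ 4 ≤ (‖Kchar D (psiFn x) w‖ +
          Real.exp 13 * ‖Nchar D (psiBarFn x) (1 - w)‖ + C' * E1main x (1 - conj w) + C' * ε) ^ 4 :=
          pow_le_pow_left₀ (norm_nonneg _) (hLψ x) 4
      _ ≤ 64 * (‖Kchar D (psiFn x) w‖ ^ 4 + (Real.exp 13 * ‖Nchar D (psiBarFn x) (1 - w)‖) ^ 4 +
            (C' * E1main x (1 - conj w)) ^ 4 + (C' * ε) ^ 4) := add_four_pow_four_le _ _ _ _
      _ = _ := by ring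
  -- the four sums
  have hSK := hK D hDK T w hw.le
  have hSN := hN D hDN T (1 - w) h1w
  have hSE := hE D hDE T (1 - conj w) h1wc
  have hcard : (T.card : ℝ) ≤ Cc * bigP D ^ 2 * ell D ^ 9 := by
    have := card_le_bigP_sq hL1 hK1 T
    rw [hCc]
    calc (T.card : ℝ) ≤ (2 + 2 * (3 + (Real.log 2 ^ 68)⁻¹) ^ 2) * bigP D ^ 2 *
          (Real.exp (8 * π) * (3 * ell D ^ 9)) := this
      _ = _ := by ring
  have hε1 : ε ^ 4 ≤ 1 := by
    apply pow_le_one₀ hε0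
    rw [hε, Real.exp_le_one_iff, neg_mul]
    exact neg_nonpos.mpr (by positivity)
  have h936 : ell D ^ 9 ≤ ell D ^ 36 := pow_le_pow_right₀ hL1 (by norm_num)
  have hCc0 : 0 ≤ Cc := by rw [hCc]; exact mul_nonneg Typed.Section13.c33_nonneg (by positivity)
  have hlast : ∑ x ∈ T, C' ^ 4 * ε ^ 4 ≤ C' ^ 4 * Cc * (bigP D ^ 2 * ell D ^ 36) := by
    rw [Finset.sum_const, nsmul_eq_mul]
    have hc36 : (T.card : ℝ) ≤ Cc * (bigP D ^ 2 * ell D ^ 36) := by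
      calc (T.card : ℝ) ≤ Cc * bigP D ^ 2 * ell D ^ 9 := hcard
        _ ≤ Cc * bigP D ^ 2 * ell D ^ 36 := mul_le_mul_of_nonneg_left h936 (by positivity)
        _ = _ := by ring
    have h1 : (T.card : ℝ) * (C' ^ 4 * ε ^ 4) ≤ (Cc * (bigP D ^ 2 * ell D ^ 36)) * (C' ^ 4 * 1) :=
      mul_le_mul hc36 (mul_le_mul_of_nonneg_left hε1 (by positivity)) (by positivity) (by positivity)
    have h2 : 0 ≤ C' ^ 4 := by positivity
    nlinarith
  calc ∑ x ∈ T, ‖x.ψ.LFunction w‖ ^ 4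
      ≤ ∑ x ∈ T, 64 * (‖Kchar D (psiFn x) w‖ ^ 4 +
          Real.exp 13 ^ 4 * ‖Nchar D (psiBarFn x) (1 - w)‖ ^ 4 + C' ^ 4 * E1main x (1 - conj w) ^ 4 +
            C' ^ 4 * ε ^ 4) := Finset.sum_le_sum fun x _ => hL4 x
    _ = 64 * (∑ x ∈ T, ‖Kchar D (psiFn x) w‖ ^ 4 +
          Real.exp 13 ^ 4 * ∑ x ∈ T, ‖Nchar D (psiBarFn x) (1 - w)‖ ^ 4 +
          C' ^ 4 * ∑ x ∈ T, E1main x (1 - conj w) ^ 4 + ∑ x ∈ T, C' ^ 4 * ε ^ 4) := by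
        rw [← Finset.mul_sum]
        congr 1
        rw [Finset.sum_add_distrib, Finset.sum_add_distrib, Finset.sum_add_distrib, ← Finset.mul_sum,
          ← Finset.mul_sum]
    _ ≤ 64 * (CK * bigP D ^ 2 * ell D ^ 36 + Real.exp 13 ^ 4 * (CN * bigP D ^ 2 * ell D ^ 36) +
          C' ^ 4 * (CE * bigP D ^ 2 * ell D ^ 36) + C' ^ 4 * Cc * (bigP D ^ 2 * ell D ^ 36)) := by
        have h13 : 0 ≤ Real.exp 13 ^ 4 := by positivity
        have hC4 : 0 ≤ C' ^ 4 := by positivity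
        have := mul_le_mul_of_nonneg_left hSN h13
        have := mul_le_mul_of_nonneg_left hSE hC4
        linarith
    _ = _ := by ring

/-- **Segment form**: for `s` on the strip `|Re s − ½| < 2α` with `|Im s − 2πt₀| ≤ 𝓛₁` (e.g.
`s ∈ 𝔍(±α)`, or the reflected point `1 − s̄`) and a purely imaginary shift `β` with `|Im β| < 2`
(the `β_j` of (2.13): `β_j = ib_j`, `0 ≤ b_j < 2`), under (A) and for all large `D`:
`Σ_{ψ∈T} |L(s+β,ψ)|⁴ ≤ C·P²·𝓛³⁶`. [cite: Zhang2022LandauSiegel, §8 p.43; §15 p.80; §2 (2.13)] -/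
theorem sum_norm_LFunction_shift_pow_four_le : ∃ C : ℝ, ForAllLarge fun D _ χ => AssumptionA D χ →
    ∀ (T : Finset (Chr D)) (s β : ℂ), |s.re - 1 / 2| < 2 * alpha D →
      |s.im - 2 * π * t0 D| ≤ ell1 D → β.re = 0 → |β.im| < 2 →
        ∑ x ∈ T, ‖x.ψ.LFunction (s + β)‖ ^ 4 ≤ C * bigP D ^ 2 * ell D ^ 36 := by
  obtain ⟨C, D₀, h⟩ := sum_norm_LFunction_pow_four_le
  refine ⟨C, D₀, fun D _ χ hD hq hp hA T s β hs him hβ hβi => ?_⟩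
  refine h D χ hD hq hp hA T (s + β) ?_ ?_
  · simpa [hβ] using hs
  · have : (s + β).im - 2 * π * t0 D = (s.im - 2 * π * t0 D) + β.im := by simp; ring
    rw [this]
    calc |s.im - 2 * π * t0 D + β.im| ≤ |s.im - 2 * π * t0 D| + |β.im| := abs_add_le _ _
      _ < ell1 D + 2 := by linarith

end Literature.NumberTheory.LFunctions.Zhang2022.FourthMoments

end
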